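import Summits.AtomisticToContinuum.BoseEinsteinCondensation.Theorems.BECHardSphereReductionHardSphereZeroModeInfraredReduction
import Literature.MathematicalPhysics.QuantumManyBody.NeumannSymmetrization

/-!
# Crux `HardSphereBEC` (stmt-11885), line `registered` — ZERO-MODE DOMINANCE for nonnegative states:
# for `Ψ ≥ 0` the infrared kernel of stub `stub_infraredBound` is purely MESOSCOPIC

Route `BECHardSphereReduction`, lead c7 (2026-08-17).  Units `a = 1`, `ħ = 2m = 1`; box `Λ_L`,
Neumann eigenbasis `u_k = ∏ᵢ c_{kᵢ} L^{-1/2} cos(kᵢπxᵢ/L)` ([FournaisEtAl2024, §2.3], vendored in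
`NeumannMomentumCutoffs`), `φ₀ = u_0 = L^{-3/2}·1_{Λ_L}`.

Lead c4 showed (p147997) that the registered stub `stub_infraredBound` / item 11888 is an INFRARED
statement: `N = ⟨φ₀,γ_Ψφ₀⟩ + n₊ᴸ(K) + n₊ᴴ(K)` and the kinetic gap makes the ultraviolet part
`n₊ᴴ(√(32πη/c)·L)` of every near-minimiser `≤ cN/4 + O(1)`; what is open is an occupation bound for
the soft modes `0 < |p| ≤ √(32πη/c)`.  This file certifies the complementary, far-infrared end FOR
NONNEGATIVE STATES (the hard-sphere ground state is `≥ 0`; the positivity routes of the summit work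
with nonnegative near-minimisers, `PositiveZeroMode`, `NonnegNearMinimiser`):

* `ZeroModeDominance.norm_modeCoeff_le_of_nonneg` — **the zero mode dominates every Neumann mode**:
  for `f ≥ 0` on the cell, `|⟨u_k, f⟩| ≤ 2^{3/2} |⟨u_0, f⟩|` (`|u_k| ≤ (2/L)^{3/2}` pointwise and
  `|∫ u_k f| ≤ ∫ |u_k| f`), hence `|⟨u_k,f⟩|² ≤ 8 |⟨u_0,f⟩|²` (`enorm_sq_modeCoeff_le_of_nonneg`) —
  the Penrose–Onsager positivity domination `n_p ≤ n_0`, in the Neumann basis of the box;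
* `ZeroModeDominance.lowOccupation_le_of_nonneg`, `…nPlusLow_le_of_nonneg` — so for a nonnegative
  Bose-symmetric state the soft modes below ANY index cut-off `K` hold at most
  `8 · #{k ≠ 0 : π|k| ≤ K} · ⟨φ₀,γ_Ψφ₀⟩` particles: `n₊ᴸ(K) ≤ 8 |𝒫_L(K)| n₀`;
* `ZeroModeDominance.card_le_of_nonneg` — `N ≤ (1 + 8|𝒫_L(K)|)·⟨φ₀,γ_Ψφ₀⟩ + n₊ᴴ(K)` for every
  nonnegative Dirichlet trial state and every `K ≥ 0`;
* `ZeroModeDominance.zeroMode_of_generalizedCondensation_of_nonneg` — **generalized condensation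
  implies zero-mode condensation for nonnegative states**: if the modes of momenta `> K/L` hold at
  most `(1 - ε)N` particles (`n₊ᴴ(K) + εN ≤ N`), then `⟨φ₀,γ_Ψφ₀⟩ ≥ εN/(1 + 8|𝒫_L(K)|)`.

Consequence for the line (recorded, not a reshape: the registered stub is `∀Ψ`-typed and sign-
changing near-minimisers need the positivity transfer of the sibling routes, `positivityTransfer_proof`):
for NONNEGATIVE near-minimisers, zero-mode BEC at a FIXED index cut-off `K₀` (finitely many modes,
momenta `≤ K₀/L → 0`) is the same as "a fraction `ε` of the particles has momentum `≤ K₀/L`", so the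
open kernel is the window `K₀/L < |p| ≤ √(32πη/c)` — neither the finitely many lowest modes (this
file) nor the ultraviolet modes (p147997) are open.  No fragmentation of a positive ground state over
the lowest box modes is possible.
-/

noncomputable section

namespace Summit.AtomisticToContinuum.BoseEinsteinCondensation.Cruxes.HardSphereBEC

open MeasureTheory ENNReal Literature.MathematicalPhysics.QuantumManyBody.BoseGas
open Literature.MathematicalPhysics.QuantumManyBody.NeumannBox
open Summit.AtomisticToContinuum.BoseEinsteinCondensation.Theorems

namespace ZeroModeDominance

variable {ℓ : ℝ}

/-! ### One body: the zero mode dominates every Neumann mode of a nonnegative function -/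

/-- `(2/ℓ)^{3/2} = 2^{3/2} · ℓ^{-3/2}`. [folklore] -/
theorem sqrt_two_div_pow_three (hℓ : 0 < ℓ) :
    Real.sqrt (2 / ℓ) ^ 3 = Real.sqrt 2 ^ 3 * (1 / Real.sqrt ℓ) ^ 3 := by
  rw [Real.sqrt_div' _ hℓ.le]; ring

/-- For a nonnegative function the integral over the cell is a nonnegative real number whose norm
is the integral of the norm. [folklore] -/
theorem norm_setIntegral_eq_of_nonneg {f : Space → ℂ} (hpos : ∀ x, f x = (‖f x‖ : ℂ)) :
    ‖∫ x in cell ℓ, f x‖ = ∫ x in cell ℓ, ‖f x‖ := by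
  have hf : (fun x => f x) = fun x => ((‖f x‖ : ℝ) : ℂ) := funext hpos
  rw [hf, integral_complex_ofReal, Complex.norm_real, Real.norm_of_nonneg]
  exact integral_nonneg fun x => norm_nonneg _

/-- **The zero mode dominates every Neumann mode (Penrose–Onsager positivity domination, Neumann
basis of the box).** For `f ≥ 0` integrable on the cell `[0,ℓ)³` and every `k ∈ ℕ₀³`,
`|⟨u_k, f⟩| ≤ 2^{3/2} |⟨u_0, f⟩|`: indeed `|∫ u_k f| ≤ ∫ |u_k| f ≤ (2/ℓ)^{3/2} ∫ f`
(`NeumannBox.abs_mode_le`) while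
`⟨u_0, f⟩ = ℓ^{-3/2} ∫ f`. [cite: PenroseOnsager1956, §4 (positivity of the ground state makes the zero-momentum occupation maximal)] -/
theorem norm_modeCoeff_le_of_nonneg (hℓ : 0 < ℓ) (k : Fin 3 → ℕ) {f : Space → ℂ}
    (hf : IntegrableOn f (cell ℓ)) (hpos : ∀ x, f x = (‖f x‖ : ℂ)) :
    ‖modeCoeff ℓ k f‖ ≤ Real.sqrt 2 ^ 3 * ‖modeCoeff ℓ 0 f‖ := by
  -- the zero-mode coefficient
  have h0 : modeCoeff ℓ 0 f = (((1 / Real.sqrt ℓ) ^ 3 : ℝ) : ℂ) * ∫ x in cell ℓ, f x := by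
    rw [modeCoeff, ← MeasureTheory.integral_const_mul]
    congr 1; funext x; rw [mode_zero]
  have hc : 0 ≤ (1 / Real.sqrt ℓ) ^ 3 := by positivity
  have hnorm0 : ‖modeCoeff ℓ 0 f‖ = (1 / Real.sqrt ℓ) ^ 3 * ∫ x in cell ℓ, ‖f x‖ := by
    rw [h0, norm_mul, Complex.norm_real, Real.norm_of_nonneg hc, norm_setIntegral_eq_of_nonneg hpos]
  -- the bound on the `k`-th coefficient
  have hbound : ‖modeCoeff ℓ k f‖ ≤ ∫ x in cell ℓ, Real.sqrt (2 / ℓ) ^ 3 * ‖f x‖ := by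
    refine norm_integral_le_of_norm_le (hf.norm.const_mul _) (Filter.Eventually.of_forall fun x => ?_)
    rw [norm_mul, Complex.norm_real, Real.norm_eq_abs]
    exact mul_le_mul_of_nonneg_right (abs_mode_le hℓ k x) (norm_nonneg _)
  rw [MeasureTheory.integral_const_mul, sqrt_two_div_pow_three hℓ, mul_assoc] at hbound
  rwa [hnorm0]

/-- Squared, in `ℝ≥0∞`: `|⟨u_k, f⟩|² ≤ 8 |⟨u_0, f⟩|²` for `f ≥ 0` integrable on the cell.
[cite: PenroseOnsager1956, §4] -/
theorem enorm_sq_modeCoeff_le_of_nonneg (hℓ : 0 < ℓ) (k : Fin 3 → ℕ) {f : Space → ℂ}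
    (hf : IntegrableOn f (cell ℓ)) (hpos : ∀ x, f x = (‖f x‖ : ℂ)) :
    ‖modeCoeff ℓ k f‖ₑ ^ 2 ≤ 8 * ‖modeCoeff ℓ 0 f‖ₑ ^ 2 := by
  have h := norm_modeCoeff_le_of_nonneg hℓ k hf hpos
  have h8 : (Real.sqrt 2 ^ 3) ^ 2 = 8 := by
    rw [← pow_mul, show 3 * 2 = 2 * 3 by norm_num, pow_mul, Real.sq_sqrt (by norm_num)]; norm_num
  have hsq : ‖modeCoeff ℓ k f‖ ^ 2 ≤ 8 * ‖modeCoeff ℓ 0 f‖ ^ 2 := by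
    calc ‖modeCoeff ℓ k f‖ ^ 2 ≤ (Real.sqrt 2 ^ 3 * ‖modeCoeff ℓ 0 f‖) ^ 2 :=
          pow_le_pow_left₀ (norm_nonneg _) h 2
      _ = 8 * ‖modeCoeff ℓ 0 f‖ ^ 2 := by rw [mul_pow, h8]
  have hofReal := ENNReal.ofReal_le_ofReal hsq
  rwa [ENNReal.ofReal_mul (by norm_num), ENNReal.ofReal_pow (norm_nonneg _),
    ENNReal.ofReal_pow (norm_nonneg _), ofReal_norm, ofReal_norm,
    ENNReal.ofReal_ofNat] at hofReal

/-- **The soft modes of a nonnegative function are dominated by its zero mode**: for `f ≥ 0`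
integrable on the cell and any index cut-off `K`,
`⟨f, Q^L f⟩ = ∑_{k ∈ 𝒫_L(K)} |⟨u_k,f⟩|² ≤ 8 |𝒫_L(K)| · |⟨u_0, f⟩|²`. [cite: PenroseOnsager1956, §4] -/
theorem lowOccupation_le_of_nonneg (K : ℝ) (hℓ : 0 < ℓ) {f : Space → ℂ}
    (hf : IntegrableOn f (cell ℓ)) (hpos : ∀ x, f x = (‖f x‖ : ℂ)) :
    lowOccupation K ℓ f ≤ 8 * (lowModes K).card * ‖modeCoeff ℓ 0 f‖ₑ ^ 2 := by
  unfold lowOccupation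
  calc ∑ k ∈ lowModes K, ‖modeCoeff ℓ k f‖ₑ ^ 2
      ≤ ∑ _k ∈ lowModes K, 8 * ‖modeCoeff ℓ 0 f‖ₑ ^ 2 :=
        Finset.sum_le_sum fun k _ => enorm_sq_modeCoeff_le_of_nonneg hℓ k hf hpos
    _ = 8 * (lowModes K).card * ‖modeCoeff ℓ 0 f‖ₑ ^ 2 := by
        rw [Finset.sum_const, nsmul_eq_mul]; ring

/-! ### `N` bodies: `n₊ᴸ(K) ≤ 8 |𝒫_L(K)| n₀` for nonnegative Bose-symmetric states -/

/-- **`⟨Ψ, n₊ᴸ(K) Ψ⟩ ≤ 8 |𝒫_L(K)| ⟨Ψ, n₀ Ψ⟩`** for a continuous, Bose-symmetric, NONNEGATIVE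
`(n+1)`-body function on the box of side `ℓ > 0` and every index cut-off `K`: slice by slice the
soft modes are dominated by the zero mode (`lowOccupation_le_of_nonneg`), and the zero-mode slice
terms summed over the particles give `n₀` (`sum_lintegral_sliceMeanSq_of_symm`).
[cite: PenroseOnsager1956, §4] -/
theorem nPlusLow_le_of_nonneg {n : ℕ} (K : ℝ) (hℓ : 0 < ℓ) {Ψ : Config (n + 1) → ℂ}
    (hΨ : Continuous Ψ)
    (hsymm : ∀ (σ : Equiv.Perm (Fin (n + 1))) (X : Config (n + 1)), Ψ (X ∘ σ) = Ψ X)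
    (hpos : ∀ X, Ψ X = (‖Ψ X‖ : ℂ)) :
    nPlusLow K ℓ (n + 1) Ψ ≤ 8 * (lowModes K).card * condensateOccupation (n + 1) ℓ Ψ := by
  rw [← sum_lintegral_sliceMeanSq_of_symm hℓ hΨ hsymm, nPlusLow, Finset.mul_sum]
  refine Finset.sum_le_sum fun i _ => ?_
  rw [mul_left_comm]
  refine mul_le_mul' le_rfl ?_
  calc ∫⁻ X in cellN (n + 1) ℓ, lowOccupation K ℓ (fun y => Ψ (Function.update X i y))
      ≤ ∫⁻ X in cellN (n + 1) ℓ, 8 * (lowModes K).card *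
          ((ENNReal.ofReal ℓ ^ 3)⁻¹ * (‖∫ x in cell ℓ, Ψ (Function.update X i x)‖₊ : ℝ≥0∞) ^ 2) := by
        refine lintegral_mono fun X => ?_
        have hcont : Continuous fun y : Space => Ψ (Function.update X i y) :=
          hΨ.comp (continuous_const.update i continuous_id)
        have h := lowOccupation_le_of_nonneg K hℓ (f := fun y => Ψ (Function.update X i y))
          (integrableOn_cell hcont) (fun y => hpos _)
        rwa [enorm_sq_modeCoeff_zero hℓ] at h
    _ = 8 * (lowModes K).card * ∫⁻ X in cellN (n + 1) ℓ,
          (ENNReal.ofReal ℓ ^ 3)⁻¹ * (‖∫ x in cell ℓ, Ψ (Function.update X i x)‖₊ : ℝ≥0∞) ^ 2 := by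
        rw [lintegral_const_mul' _ _ (by
          exact ENNReal.mul_ne_top (by norm_num) (ENNReal.natCast_ne_top _))]

/-! ### Dirichlet trial states: `N ≤ (1 + 8|𝒫_L(K)|) n₀ + n₊ᴴ(K)` and generalized ⟹ zero-mode condensation -/

variable {n : ℕ} {L : ℝ}

/-- **`N ≤ (1 + 8 |𝒫_L(K)|) ⟨φ₀,γ_Ψφ₀⟩ + n₊ᴴ(K)`** for every NONNEGATIVE `(n+1)`-body Dirichlet
trial state in the box of side `L > 0` and every index cut-off `K ≥ 0`: `N = n₀ + n₊ᴸ + n₊ᴴ`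
(`occupation_add_nPlusLow_add_nPlusHigh`, p147997) and `n₊ᴸ ≤ 8|𝒫_L|n₀`. [folklore] -/
theorem card_le_of_nonneg {K : ℝ} (hK : 0 ≤ K) (hL : 0 < L) (Ψ : TrialState (n + 1) L)
    (hpos : ∀ X, Ψ.ψ X = (‖Ψ.ψ X‖ : ℂ)) :
    ((n + 1 : ℕ) : ℝ≥0∞) ≤
      (1 + 8 * (lowModes K).card) *
          occupation (n + 1) ((box L).indicator fun _ => ((Real.sqrt (L ^ 3))⁻¹ : ℂ)) Ψ.ψ +
        nPlusHigh K L (n + 1) Ψ.ψ := by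
  have hsum := occupation_add_nPlusLow_add_nPlusHigh hK hL Ψ
  have hlow : nPlusLow K L (n + 1) Ψ.ψ ≤ 8 * (lowModes K).card *
      occupation (n + 1) ((box L).indicator fun _ => ((Real.sqrt (L ^ 3))⁻¹ : ℂ)) Ψ.ψ := by
    rw [occupation_boxMode_eq_condensateOccupation]
    exact nPlusLow_le_of_nonneg K hL Ψ.contDiff.continuous Ψ.symm hpos
  calc ((n + 1 : ℕ) : ℝ≥0∞)
      = occupation (n + 1) ((box L).indicator fun _ => ((Real.sqrt (L ^ 3))⁻¹ : ℂ)) Ψ.ψ +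
          nPlusLow K L (n + 1) Ψ.ψ + nPlusHigh K L (n + 1) Ψ.ψ := hsum.symm
    _ ≤ occupation (n + 1) ((box L).indicator fun _ => ((Real.sqrt (L ^ 3))⁻¹ : ℂ)) Ψ.ψ +
          8 * (lowModes K).card *
            occupation (n + 1) ((box L).indicator fun _ => ((Real.sqrt (L ^ 3))⁻¹ : ℂ)) Ψ.ψ +
          nPlusHigh K L (n + 1) Ψ.ψ := by gcongr
    _ = (1 + 8 * (lowModes K).card) *
          occupation (n + 1) ((box L).indicator fun _ => ((Real.sqrt (L ^ 3))⁻¹ : ℂ)) Ψ.ψ +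
        nPlusHigh K L (n + 1) Ψ.ψ := by ring

/-- **Generalized condensation implies zero-mode condensation for nonnegative states.** If a
NONNEGATIVE `(n+1)`-body Dirichlet trial state in the box of side `L > 0` has at most `(1-ε)N`
particles at momenta above the index cut-off `K ≥ 0` — `n₊ᴴ(K) + εN ≤ N`, i.e. a fraction `ε` of
the particles occupies the finitely many Neumann modes `π|k| ≤ K` (momenta `≤ K/L`) — then the zero
mode alone is macroscopically occupied: `⟨φ₀, γ_Ψ φ₀⟩ ≥ εN / (1 + 8|𝒫_L(K)|)`.  For sign-changing
states this is false (a state condensed in `u_k`, `k ≠ 0`). [cite: PenroseOnsager1956, §4] -/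
theorem zeroMode_of_generalizedCondensation_of_nonneg {K ε : ℝ} (hK : 0 ≤ K) (hL : 0 < L)
    (Ψ : TrialState (n + 1) L) (hpos : ∀ X, Ψ.ψ X = (‖Ψ.ψ X‖ : ℂ))
    (hgen : nPlusHigh K L (n + 1) Ψ.ψ + ENNReal.ofReal (ε * ((n + 1 : ℕ) : ℝ)) ≤ ((n + 1 : ℕ) : ℝ≥0∞)) :
    ENNReal.ofReal (ε * ((n + 1 : ℕ) : ℝ) / (1 + 8 * (lowModes K).card)) ≤
      occupation (n + 1) ((box L).indicator fun _ => ((Real.sqrt (L ^ 3))⁻¹ : ℂ)) Ψ.ψ := by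
  set occ := occupation (n + 1) ((box L).indicator fun _ => ((Real.sqrt (L ^ 3))⁻¹ : ℂ)) Ψ.ψ
    with hocc
  have hcard := card_le_of_nonneg hK hL Ψ hpos
  -- `n₊ᴴ` is finite (it is at most `N`)
  have hhigh : nPlusHigh K L (n + 1) Ψ.ψ ≠ ⊤ :=
    ne_top_of_le_ne_top (ENNReal.natCast_ne_top (n + 1)) ((le_add_right le_rfl).trans hgen)
  -- `εN + n₊ᴴ ≤ N ≤ (1 + 8M) occ + n₊ᴴ`
  have h1 : ENNReal.ofReal (ε * ((n + 1 : ℕ) : ℝ)) + nPlusHigh K L (n + 1) Ψ.ψ ≤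
      (1 + 8 * (lowModes K).card) * occ + nPlusHigh K L (n + 1) Ψ.ψ := by
    rw [add_comm]; exact hgen.trans hcard
  have h2 : ENNReal.ofReal (ε * ((n + 1 : ℕ) : ℝ)) ≤ (1 + 8 * (lowModes K).card) * occ :=
    (ENNReal.add_le_add_iff_right hhigh).1 h1
  have hM : (0 : ℝ) < 1 + 8 * ((lowModes K).card : ℝ) := by positivity
  have hMe : ((1 : ℝ≥0∞) + 8 * (lowModes K).card) = ENNReal.ofReal (1 + 8 * ((lowModes K).card : ℝ)) := by
    rw [ENNReal.ofReal_add zero_le_one (by positivity), ENNReal.ofReal_one,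
      ENNReal.ofReal_mul (by norm_num), ENNReal.ofReal_ofNat, ENNReal.ofReal_natCast]
  rw [ENNReal.ofReal_div_of_pos hM]
  refine ENNReal.div_le_of_le_mul' ?_
  rwa [← hMe]

end ZeroModeDominance

end Summit.AtomisticToContinuum.BoseEinsteinCondensation.Cruxes.HardSphereBEC

end
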